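import Mathlib
import HarnessLib
import Summits.Ventures.LatticeQCDFlow.Exactness.GaussianQuadraticEquipartition

/-!
# The second moment of the engine's kinetic energy: `⟨q(p_l)²⟩ = D(D+2)/4`, `Var q(p_l) = D/2` — the χ²-law check of the heat-bath

HONEST FRAMING: exact (Metropolis-corrected) sampling algorithms for lattice gauge theory;
figures of merit are autocorrelation/cost numbers at stated couplings and volumes; no
continuum-physics claim.

Venture `LatticeQCDFlow` (cell pub-lqcd), topic `Exactness`, FANOUT row 14 (eng-flowhmc; the `SU(N)`
momentum heat-bath of the engine, density `∝ e^{−q}` per link in the coordinates `SUNCoords N`,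
`q = sunCoordQuad N = −tr P²`).  NEW WORK of the cell over `GaussianQuadraticEquipartition` (the scaling
law `∫e^{−tq} = t^{−D/2}∫e^{−q}`, differentiation under the integral, `∫ q e^{−q} = (D/2)∫e^{−q}`,
`D + 1 = N²`); nothing here is cited as a fact.

* §1 (general coercive degree-two homogeneous continuous weight `q` on a finite-dimensional real normed
  space with an additive Haar measure): the first-moment scaling law
  **`∫ q e^{−tq} = t^{−(D/2+1)} ∫ q e^{−q}`** (`integral_quadHom_mul_exp_neg_mul`), differentiation
  under the integral sign of `t ↦ ∫ q e^{−tq}` at `t = 1` (bound `64 e^{−q/4}`), and THE SECOND-MOMENT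
  IDENTITY **`∫ q² e^{−q} = (D/2)(D/2 + 1) ∫ e^{−q}`** (`integral_quadHom_sq_mul_exp_neg`).
* §2 (the engine): **`E q(p_l)² = (D/2)(D/2+1)`** and **`E (q(p_l) − D/2)² = D/2`** per link under the
  refresh law (`integral_sunCoordQuad_sq_apply_sunKineticLaw`, `variance_sunCoordQuad_apply_sunKineticLaw`);
  with `D = N² − 1`: `E q(p_l)² = (N²−1)(N²+1)/4`, `Var q(p_l) = (N²−1)/2` — the first two moments of
  the `χ²_D/2` law that the heat-bath check of an HMC code compares against.

NOT CLAIMED: the full law (all moments / the `χ²` density); independence across links as a Lean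
statement (so no `Var Σ_l q(p_l)` here); anything numerical.
-/

noncomputable section
namespace Summit.Ventures.LatticeQCDFlow.Exactness

open Set MeasureTheory Filter Topology
open scoped ENNReal

/-! ## §1 Second moment for a coercive degree-two homogeneous weight -/

section General
variable {E : Type*} [NormedAddCommGroup E] [NormedSpace ℝ E] [FiniteDimensional ℝ E]
  [MeasurableSpace E] [BorelSpace E] (μ : Measure E) [μ.IsAddHaarMeasure]
  {q : E → ℝ} {m : ℝ}

omit [NormedSpace ℝ E] [FiniteDimensional ℝ E] [MeasurableSpace E] [BorelSpace E] in
/-- `q² e^{−q/4} ≤ 64` (`q e^{−q/8} ≤ 8` squared). -/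
theorem quadHom_sq_mul_exp_neg_quarter_le (hm : 0 < m) (hcoer : ∀ x, m * ‖x‖ ^ 2 ≤ q x) (x : E) :
    q x ^ 2 * Real.exp (-(1 / 4 * q x)) ≤ 64 := by
  have hq := quadHom_nonneg hm hcoer x
  have h1 : q x / 8 ≤ Real.exp (q x / 8) := by linarith [Real.add_one_le_exp (q x / 8)]
  have h2 : Real.exp (-(1 / 4 * q x)) = ((Real.exp (q x / 8)) ^ 2)⁻¹ := by
    rw [← Real.exp_nat_mul, ← Real.exp_neg]; congr 1; push_cast; ring
  have hpos : 0 < Real.exp (q x / 8) ^ 2 := by positivity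
  rw [h2, mul_inv_le_iff₀ hpos]
  have h3 : q x ≤ 8 * Real.exp (q x / 8) := by linarith
  calc q x ^ 2 ≤ (8 * Real.exp (q x / 8)) ^ 2 := pow_le_pow_left₀ hq h3 2
    _ = 64 * Real.exp (q x / 8) ^ 2 := by ring

/-- **First-moment scaling law**: `∫ q e^{−tq} dμ = t^{−(D/2+1)} ∫ q e^{−q} dμ` for `t > 0`. -/
theorem integral_quadHom_mul_exp_neg_mul (hhom : ∀ (s : ℝ) (x : E), q (s • x) = s ^ 2 * q x)
    {t : ℝ} (ht : 0 < t) :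
    ∫ x, q x * Real.exp (-(t * q x)) ∂μ =
      t ^ (-(Module.finrank ℝ E : ℝ) / 2 - 1) * ∫ x, q x * Real.exp (-q x) ∂μ := by
  -- `∫ (q e^{−q})(√t • x) = t^{−D/2} ∫ q e^{−q}` and `(q e^{−q})(√t • x) = t · q(x) e^{−t q(x)}`
  have hs : ∀ x : E, q (Real.sqrt t • x) * Real.exp (-q (Real.sqrt t • x)) = t * (q x * Real.exp (-(t * q x))) := by
    intro x; rw [hhom, Real.sq_sqrt ht.le]; ring
  have hscale := Measure.integral_comp_smul μ (fun x => q x * Real.exp (-q x)) (Real.sqrt t)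
  simp only [hs, smul_eq_mul] at hscale
  rw [integral_const_mul] at hscale
  have hpow : |(Real.sqrt t ^ Module.finrank ℝ E)⁻¹| = t ^ (-(Module.finrank ℝ E : ℝ) / 2) := by
    rw [abs_of_nonneg (by positivity), ← Real.rpow_natCast, ← Real.rpow_neg (Real.sqrt_nonneg _),
      Real.sqrt_eq_rpow, ← Real.rpow_mul ht.le]
    congr 1; ring
  rw [hpow] at hscale
  have ht0 : t ≠ 0 := ht.ne'
  have hsplit : t ^ (-(Module.finrank ℝ E : ℝ) / 2 - 1) = t⁻¹ * t ^ (-(Module.finrank ℝ E : ℝ) / 2) := by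
    rw [sub_eq_add_neg, Real.rpow_add ht, Real.rpow_neg_one, mul_comm]
  rw [hsplit, mul_assoc, ← hscale, ← mul_assoc, inv_mul_cancel₀ ht0, one_mul]

/-- **Differentiation under the integral sign** for the first moment at `t = 1`:
`d/dt ∫ q e^{−tq} |_{t=1} = −∫ q² e^{−q}`, and `q² e^{−q}` is integrable. -/
theorem hasDerivAt_integral_quadHom_mul_exp_neg_mul (hq : Continuous q) (hm : 0 < m)
    (hcoer : ∀ x, m * ‖x‖ ^ 2 ≤ q x) :
    Integrable (fun x => -(q x ^ 2) * Real.exp (-(1 * q x))) μ ∧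
      HasDerivAt (fun t : ℝ => ∫ x, q x * Real.exp (-(t * q x)) ∂μ)
        (∫ x, -(q x ^ 2) * Real.exp (-(1 * q x)) ∂μ) 1 := by
  have hq0 := quadHom_nonneg hm hcoer
  have hs : Set.Ioi (1 / 2 : ℝ) ∈ 𝓝 (1 : ℝ) := Ioi_mem_nhds (by norm_num)
  refine hasDerivAt_integral_of_dominated_loc_of_deriv_le (F := fun t x => q x * Real.exp (-(t * q x)))
    (F' := fun t x => -(q x ^ 2) * Real.exp (-(t * q x))) (bound := fun x => 64 * Real.exp (-(1 / 4 * q x)))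
    (x₀ := (1 : ℝ)) hs ?_ ?_ ?_ ?_ ?_ ?_
  · exact Eventually.of_forall fun t => (hq.mul (continuous_const.mul hq).neg.rexp).aestronglyMeasurable
  · have h := (hasDerivAt_integral_exp_neg_mul_quadHom μ hq hm hcoer).1
    refine h.neg.congr (Eventually.of_forall fun x => ?_)
    simp only [Pi.neg_apply, neg_mul, neg_neg]
  · exact ((hq.pow 2).neg.mul (continuous_const.mul hq).neg.rexp).aestronglyMeasurable
  · refine Eventually.of_forall fun x t ht => ?_
    have ht' : 1 / 2 < t := ht
    rw [norm_mul, norm_neg, Real.norm_eq_abs, abs_of_nonneg (sq_nonneg _), Real.norm_eq_abs,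
      abs_of_pos (Real.exp_pos _)]
    have hexp : Real.exp (-(t * q x)) ≤ Real.exp (-(1 / 4 * q x)) * Real.exp (-(1 / 4 * q x)) := by
      rw [← Real.exp_add]
      exact Real.exp_le_exp.2 (by nlinarith [hq0 x])
    calc q x ^ 2 * Real.exp (-(t * q x))
        ≤ q x ^ 2 * (Real.exp (-(1 / 4 * q x)) * Real.exp (-(1 / 4 * q x))) :=
          mul_le_mul_of_nonneg_left hexp (sq_nonneg _)
      _ = (q x ^ 2 * Real.exp (-(1 / 4 * q x))) * Real.exp (-(1 / 4 * q x)) := by ring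
      _ ≤ 64 * Real.exp (-(1 / 4 * q x)) :=
          mul_le_mul_of_nonneg_right (quadHom_sq_mul_exp_neg_quarter_le hm hcoer x) (Real.exp_pos _).le
  · exact (integrable_exp_neg_mul_quadHom μ hq hm hcoer (by norm_num : (0 : ℝ) < 1 / 4)).const_mul 64
  · refine Eventually.of_forall fun x t _ => ?_
    have h := (((hasDerivAt_id t).mul_const (q x)).neg.exp).const_mul (q x)
    simpa [mul_comm, sq, mul_assoc, mul_left_comm] using h

/-- **THE SECOND-MOMENT IDENTITY**: `∫ q² e^{−q} dμ = (D/2)·(D/2 + 1)·∫ e^{−q} dμ`. -/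
theorem integral_quadHom_sq_mul_exp_neg (hq : Continuous q) (hm : 0 < m)
    (hcoer : ∀ x, m * ‖x‖ ^ 2 ≤ q x) (hhom : ∀ (s : ℝ) (x : E), q (s • x) = s ^ 2 * q x) :
    ∫ x, q x ^ 2 * Real.exp (-q x) ∂μ =
      (Module.finrank ℝ E : ℝ) / 2 * ((Module.finrank ℝ E : ℝ) / 2 + 1) * ∫ x, Real.exp (-q x) ∂μ := by
  set Z : ℝ := ∫ x, Real.exp (-q x) ∂μ with hZ
  set J : ℝ := ∫ x, q x * Real.exp (-q x) ∂μ with hJ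
  set D : ℕ := Module.finrank ℝ E with hD
  have hJ' : J = (D : ℝ) / 2 * Z := integral_quadHom_mul_exp_neg μ hq hm hcoer hhom
  have h1 := (hasDerivAt_integral_quadHom_mul_exp_neg_mul μ hq hm hcoer).2
  have heq : (fun t : ℝ => ∫ x, q x * Real.exp (-(t * q x)) ∂μ) =ᶠ[𝓝 1]
      fun t : ℝ => t ^ (-(D : ℝ) / 2 - 1) * J := by
    filter_upwards [Ioi_mem_nhds (zero_lt_one' ℝ)] with t ht
    exact integral_quadHom_mul_exp_neg_mul μ hhom ht
  have h2 : HasDerivAt (fun t : ℝ => t ^ (-(D : ℝ) / 2 - 1) * J)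
      ((-(D : ℝ) / 2 - 1) * (1 : ℝ) ^ (-(D : ℝ) / 2 - 1 - 1) * J) 1 :=
    ((Real.hasDerivAt_rpow_const (Or.inl one_ne_zero))).mul_const J
  rw [Real.one_rpow] at h2
  have h3 := h2.congr_of_eventuallyEq heq
  have huniq := h1.unique h3
  have hlhs : ∫ x, -(q x ^ 2) * Real.exp (-(1 * q x)) ∂μ = -∫ x, q x ^ 2 * Real.exp (-q x) ∂μ := by
    rw [← integral_neg]
    refine integral_congr_ae (Eventually.of_forall fun x => ?_)
    simp only [one_mul, neg_mul]
  rw [hlhs, hJ'] at huniq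
  have : ∫ x, q x ^ 2 * Real.exp (-q x) ∂μ = ((D : ℝ) / 2 + 1) * ((D : ℝ) / 2 * Z) := by linarith
  rw [this]; ring
end General

/-! ## §2 The engine's refresh: `E q(p_l)² = (D/2)(D/2+1)`, `Var q(p_l) = D/2` -/

section Engine
variable (N : ℕ) (μ : Measure (SUNCoords N)) [μ.IsAddHaarMeasure]

/-- `∫ q² e^{−q} dμ = (D/2)(D/2+1)·∫ e^{−q} dμ` for the engine's one-link Gaussian. -/
theorem integral_sunCoordQuad_sq_mul_exp_neg :
    ∫ c, sunCoordQuad N c ^ 2 * Real.exp (-sunCoordQuad N c) ∂μ =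
      (Module.finrank ℝ (SUNCoords N) : ℝ) / 2 * ((Module.finrank ℝ (SUNCoords N) : ℝ) / 2 + 1) *
        ∫ c, Real.exp (-sunCoordQuad N c) ∂μ :=
  integral_quadHom_sq_mul_exp_neg μ (continuous_sunCoordQuad N) one_pos
    (fun c => by simpa only [one_mul] using norm_sq_le_sunCoordQuad N c) (sunCoordQuad_smul N)

/-- `q² e^{−q}` is integrable (one link). -/
theorem integrable_sunCoordQuad_sq_mul_exp_neg :
    Integrable (fun c => sunCoordQuad N c ^ 2 * Real.exp (-sunCoordQuad N c)) μ := by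
  have h := (hasDerivAt_integral_quadHom_mul_exp_neg_mul μ (continuous_sunCoordQuad N) one_pos
    (fun c => by simpa only [one_mul] using norm_sq_le_sunCoordQuad N c)).1
  refine h.neg.congr (Eventually.of_forall fun c => ?_)
  simp only [Pi.neg_apply, one_mul, neg_mul, neg_neg]

variable {L : Type*} [Fintype L]

/-- **`E q(p_l)² = (D/2)(D/2+1)`** per link under the engine's refresh law. -/
theorem integral_sunCoordQuad_sq_apply_sunKineticLaw (l : L) :
    ∫ p, sunCoordQuad N (p l) ^ 2 ∂(sunMomentumLaw (L := L) μ (sunKinetic N)) =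
      (Module.finrank ℝ (SUNCoords N) : ℝ) / 2 * ((Module.finrank ℝ (SUNCoords N) : ℝ) / 2 + 1) := by
  rw [integral_apply_sunMomentumLaw_sunKinetic N μ (φ := fun c => sunCoordQuad N c ^ 2) (fun _ => sq_nonneg _)
    ((continuous_sunCoordQuad N).pow 2).measurable (integrable_sunCoordQuad_sq_mul_exp_neg N μ) l,
    integral_sunCoordQuad_sq_mul_exp_neg, mul_div_assoc,
    div_self (integral_exp_neg_sunCoordQuad_pos N μ).ne', mul_one]

/-- `q(p_l)²` is integrable under the refresh law. -/
theorem integrable_sunCoordQuad_sq_apply_sunKineticLaw (l : L) :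
    Integrable (fun p : L → SUNCoords N => sunCoordQuad N (p l) ^ 2) (sunMomentumLaw (L := L) μ (sunKinetic N)) :=
  integrable_apply_sunMomentumLaw_sunKinetic N μ (φ := fun c => sunCoordQuad N c ^ 2) (fun _ => sq_nonneg _)
    ((continuous_sunCoordQuad N).pow 2).measurable (integrable_sunCoordQuad_sq_mul_exp_neg N μ) l

/-- **`Var q(p_l) = E (q(p_l) − D/2)² = D/2`** per link under the engine's refresh law. -/
theorem variance_sunCoordQuad_apply_sunKineticLaw (l : L) :
    ∫ p, (sunCoordQuad N (p l) - (Module.finrank ℝ (SUNCoords N) : ℝ) / 2) ^ 2 ∂(sunMomentumLaw (L := L) μ (sunKinetic N)) =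
      (Module.finrank ℝ (SUNCoords N) : ℝ) / 2 := by
  set ν := sunMomentumLaw (L := L) μ (sunKinetic N) with hν
  haveI : IsProbabilityMeasure ν := isProbabilityMeasure_sunMomentumLaw_sunKinetic N μ
  set D : ℝ := (Module.finrank ℝ (SUNCoords N) : ℝ) with hD
  have h2 := integral_sunCoordQuad_sq_apply_sunKineticLaw N μ l
  have h1 := integral_sunCoordQuad_apply_sunKineticLaw N μ l
  have hi2 := integrable_sunCoordQuad_sq_apply_sunKineticLaw N μ l
  have hi1 := integrable_sunCoordQuad_apply_sunKineticLaw N μ l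
  have hexp : ∀ p : L → SUNCoords N, (sunCoordQuad N (p l) - D / 2) ^ 2 =
      sunCoordQuad N (p l) ^ 2 - D * sunCoordQuad N (p l) + (D / 2) ^ 2 := fun p => by ring
  simp_rw [hexp]
  have hDq : Integrable (fun p : L → SUNCoords N => D * sunCoordQuad N (p l)) ν := hi1.const_mul D
  have hsub : Integrable (fun p : L → SUNCoords N => sunCoordQuad N (p l) ^ 2 - D * sunCoordQuad N (p l)) ν :=
    hi2.sub hDq
  rw [integral_add hsub (integrable_const _), integral_sub hi2 hDq, integral_const_mul, integral_const, smul_eq_mul,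
    probReal_univ, one_mul, h2, h1]
  ring

/-- **With `D = N² − 1` written out** (`N ≥ 1`): `E q(p_l)² = ((N²−1)/2)((N²−1)/2 + 1)` and
`Var q(p_l) = (N² − 1)/2` — the first two moments of the `½χ²_{N²−1}` law of `−tr P_l²`. -/
theorem sunCoordQuad_apply_sunKineticLaw_moments_eq (hN : 1 ≤ N) (l : L) :
    ∫ p, sunCoordQuad N (p l) ^ 2 ∂(sunMomentumLaw (L := L) μ (sunKinetic N)) =
        ((N : ℝ) ^ 2 - 1) / 2 * (((N : ℝ) ^ 2 - 1) / 2 + 1) ∧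
      ∫ p, (sunCoordQuad N (p l) - ((N : ℝ) ^ 2 - 1) / 2) ^ 2 ∂(sunMomentumLaw (L := L) μ (sunKinetic N)) =
        ((N : ℝ) ^ 2 - 1) / 2 := by
  rw [← finrank_sunCoords_eq N hN]
  exact ⟨integral_sunCoordQuad_sq_apply_sunKineticLaw N μ l, variance_sunCoordQuad_apply_sunKineticLaw N μ l⟩
end Engine

end Summit.Ventures.LatticeQCDFlow.Exactness
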